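import Summits.BirchSwinnertonDyer.BirchSwinnertonDyer.Theorems.KolyvaginRoadThreeZhangTriangulation
import Summits.BirchSwinnertonDyer.BirchSwinnertonDyer.Theorems.KolyvaginRoadThreeZhangInductionOnPos
import HarnessLib

/-!
# Route `KolyvaginRoadThree`, deciding crux `ZhangSharpFrameAtThreeHL` (item stmt-BirchSwinnertonDyer-19574):
# W. Zhang's induction with the TRIANGULATION (A3) DISCHARGED — the METHOD engine from (A1) rank lowering, (A2)
# congruence transport, (A4) relaxation, (A5) base case, (A6) parity and KOLYVAGIN-SYSTEM AXIOMS at each good level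
# (cell `bsd-stepL`, ACCEL seat `bsd-stepL-koly3b` g3; `--supports stmt-BirchSwinnertonDyer-19574`, helper; composes
# `ZhangInductionOnPos.exists_ne_zero_of_zhangInduction_on_pos` (koly3b g2, p471131) with
# `ZhangTriangulation.triangulation` (koly3b g3, Lemma 8.4 (1)+(3) as linear algebra))

HONEST FRAMING. Pure linear algebra over an arbitrary field `F`; nothing about elliptic curves, Heegner points,
level raising or `p = 3` is asserted; every number-theoretic input is an explicitly named HYPOTHESIS SHAPE; 0
definitions, 0 named facts, 0 `sorry`. PARTITION: O2@3 (B10) × A1 × crux 19574 — none (composition engine; types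
nothing, closes nothing; T7).

THE POINT (plan g27 RULING 2026-08-26T23:40:43Z on koly3b g2's STUB-B-ABOVE-BOTTOM finding, repair R-b: «pin κ(·,n)
by Kolyvagin-system AXIOMS relative to the level-n structure … then (A3) becomes DERIVABLE à la Lemma 8.4»). The
registered METHOD engine of the crux (`ZhangInduction…`, zhang3-p1 ∕ koly3a ∕ koly3b) takes SIX axiom shapes
(A1)–(A6) as data; the cell showed (A6) idle above the bottom (koly3a p462319) and (A3) idle AT the bottom (koly3b
p471131), and that a stub positing (A3) ∕ (A2) ∕ (A5) over FREE classes is junk-satisfiable (koly3b p471571). This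
file removes (A3) from the list of posits: it is replaced by the AXIOMS of a Kolyvagin system at each good level —
W. Zhang §8.1 property (1) (Selmer off the support, transverse on it), the consequence of (8.1) «`loc_ℓ c(mℓ) = 0 ⟺
loc_ℓ c(m) = 0`», alternating signs — together with the level-independent inputs (REC) global reciprocity of the
local pairings (a tree theorem for totally complex `K`), (Cheb) = Zhang Lemma 8.1 = McCallum Prop. 3.1, (Supply) =
Zhang Lemma 8.2 = McCallum Lemma 5.3, and the local picture at Kolyvagin primes ((Perf) ∕ (Line) ∕ (Iso)). The
triangulation at every good non-empty even level carrying a non-zero class is then `ZhangTriangulation.triangulation`.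

Data (all abstract): levels `n : Finset Q` (finite sets of admissible primes) with a predicate `Good`; Kolyvagin
levels `m : Finset ι` (finite sets of Kolyvagin primes, `pl ℓ` the place of `ℓ`, `plQ q` the place of `q`);
classes `κ m n ∈ H`; eigen-Selmer spaces `Sel n s`, relaxed spaces `SelRel n S s`, base loci `B n ⊆ Q` INSIDE the
vanishing locus of `κ(·, n)` (`hB`; Zhang Def. 8.3); the level-`n` Selmer structure `L n v` (finite ∕ ordinary ∕ at
`p`) with the printed membership of `Sel n s` and `SelRel n (B n) s`. What this does NOT do: construct any of it at
`p = 3`, `3 ∥ N` (the R-c objects: level-raised forms `g_n`, `A_n[𝔭_n] ≅ E[3]`, the classes `c(m, n)`), or prove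
(A1) ∕ (A2) ∕ (A5) ∕ (Cheb) ∕ (Supply) there.

References: [cite: WZhang2014, §8.1, Lemma 8.1, Lemma 8.2, Lemma 8.4, §9 proof of Thm. 9.1 (pp. 234–242)]
[cite: McCallumLMS1991, Prop. 3.1, Lemma 5.3] [cite: Howard2006Bipartite, §2.2–§2.3].
-/

namespace Summit.BirchSwinnertonDyer.Rank1Residual.X11b.Three.Koly.ZhangTriangulation

open Module Finset

variable {F : Type*} [Field F] {H : Type*} [AddCommGroup H] [Module F H]
variable {P : Type*} {Hv : P → Type*} [∀ v, AddCommGroup (Hv v)] [∀ v, Module F (Hv v)]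
variable {ι : Type*} {Q : Type*}

/-- **W. Zhang's induction (Thm. 9.1) on good levels with the triangulation (A3) DERIVED from Kolyvagin-system
axioms.** Hypotheses: the engine's (A1) rank lowering, (A2) congruence transport, (A4) relaxation, (A5) base case,
(A6) parity — all relativised to `Good` levels, exactly as in `ZhangInductionOnPos.exists_ne_zero_of_zhangInduction_on_pos`
— and, INSTEAD of (A3): at every good level `n` the printed membership of `Sel n s` ∕ `SelRel n (B n) s` in terms of
the eigenspaces `E s`, the localisations and the level-`n` Selmer structure `L n`; finiteness of the relaxed
spaces; `B n` inside the vanishing locus of `κ(·, n)`; the Kolyvagin-system axioms for `κ(·, n)` (property (1),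
(8.1) as used, signs `ε₀ n ^^ Nat.bodd m.card`); and the level-independent inputs (REC), (Cheb) ×2, (Supply) (per
level, for the structure `L n`), (Perf), (Line), (Iso). Conclusion: a non-zero class `κ m n` at every good even
level. Proof: (A3) at a good level with a non-zero class is `ZhangTriangulation.triangulation` for the system
`κ(·, n)` with `B := plQ '' B n`; then the registered engine. CONDITIONAL on every binder; uniform in `F`; nothing
is booked. [cite: WZhang2014, Thm. 9.1, Lemma 8.4, §8.1] [cite: McCallumLMS1991, Prop. 3.1, Lemma 5.3] -/
theorem exists_ne_zero_of_zhangInduction_on_of_kolyvaginSystem [DecidableEq ι] [DecidableEq P] [DecidableEq Q]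
    (Good : Finset Q → Prop)
    (Sel : Finset Q → Bool → Submodule F H) (SelRel : Finset Q → Set Q → Bool → Submodule F H)
    (B : Finset Q → Set Q) (κ : Finset ι → Finset Q → H) (m₁ : Finset ι)
    -- Kolyvagin-system data: eigenspaces, local spaces ∕ pairings, level-n Selmer structures, places, signs
    (E : Bool → Submodule F H) (loc : (v : P) → H →ₗ[F] Hv v) (b : (v : P) → Hv v →ₗ[F] Hv v →ₗ[F] F)
    (L : Finset Q → (v : P) → Submodule F (Hv v)) (pl : ι → P) (plQ : Q → P)
    (Fv Tv : (ℓ : ι) → Submodule F (Hv (pl ℓ))) (ε₀ : Finset Q → Bool)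
    -- the level-n Selmer spaces have the printed membership; relaxed spaces finite; B n ⊆ vanishing locus
    (hSel : ∀ n, Good n → ∀ (s : Bool) (x : H), x ∈ Sel n s ↔ x ∈ E s ∧ ∀ v, loc v x ∈ L n v)
    (hSelRel : ∀ n, Good n → ∀ (s : Bool) (x : H),
      x ∈ SelRel n (B n) s ↔ x ∈ E s ∧ ∀ v, v ∉ plQ '' B n → loc v x ∈ L n v)
    (hfin : ∀ (n : Finset Q) (S : Set Q) (s : Bool), FiniteDimensional F (SelRel n S s))
    (hB : ∀ n, ∀ q ∈ B n, ∀ m, loc (plQ q) (κ m n) = 0)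
    -- the local picture at Kolyvagin primes and global reciprocity
    (hpl : Function.Injective pl)
    (hLF : ∀ n ℓ, L n (pl ℓ) = Fv ℓ)
    (hisoL : ∀ n (v : P), ∀ x ∈ L n v, ∀ y ∈ L n v, b v x y = 0)
    (hisoT : ∀ (ℓ : ι), ∀ x ∈ Tv ℓ, ∀ y ∈ Tv ℓ, b (pl ℓ) x y = 0)
    (hperf : ∀ (ℓ : ι) (s : Bool), ∀ x ∈ E s, ∀ y ∈ E s, loc (pl ℓ) x ∈ Fv ℓ → loc (pl ℓ) x ≠ 0 →
      loc (pl ℓ) y ∈ Tv ℓ → loc (pl ℓ) y ≠ 0 → b (pl ℓ) (loc (pl ℓ) x) (loc (pl ℓ) y) ≠ 0)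
    (hline : ∀ (ℓ : ι) (s : Bool), ∃ e : Hv (pl ℓ), ∀ x ∈ E s, loc (pl ℓ) x ∈ Fv ℓ →
      ∃ a : F, loc (pl ℓ) x = a • e)
    (hrec : ∀ (x y : H) (T : Finset P), (∀ v, v ∉ T → b v (loc v x) (loc v y) = 0) →
      ∑ v ∈ T, b v (loc v x) (loc v y) = 0)
    -- Kolyvagin-system axioms at each good level: signs, property (1) off ∕ on the support, (8.1) as used
    (hcE : ∀ n, Good n → ∀ m : Finset ι, κ m n ∈ E (ε₀ n ^^ Nat.bodd m.card))
    (hcL : ∀ n, Good n → ∀ (m : Finset ι) (v : P), (∀ ℓ ∈ m, pl ℓ ≠ v) → loc v (κ m n) ∈ L n v)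
    (hcT : ∀ n, Good n → ∀ (m : Finset ι), ∀ ℓ ∈ m, loc (pl ℓ) (κ m n) ∈ Tv ℓ)
    (hfs : ∀ n, Good n → ∀ (m : Finset ι) (ℓ : ι), ℓ ∉ m →
      (loc (pl ℓ) (κ (insert ℓ m) n) = 0 ↔ loc (pl ℓ) (κ m n) = 0))
    -- (Cheb) = Lemma 8.1 (one class; two classes of opposite signs), (Supply) = Lemma 8.2 for the structure L n
    (hCheb1 : ∀ x : H, x ≠ 0 → ∀ S : Finset ι, ∃ ℓ, ℓ ∉ S ∧ loc (pl ℓ) x ≠ 0)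
    (hCheb2 : ∀ (s : Bool), ∀ x ∈ E s, ∀ y ∈ E (!s), x ≠ 0 → y ≠ 0 → ∀ S : Finset ι,
      ∃ ℓ, ℓ ∉ S ∧ loc (pl ℓ) x ≠ 0 ∧ loc (pl ℓ) y ≠ 0)
    (hSupply : ∀ n, Good n → ∀ (ℓ : ι) (S : Finset ι), ℓ ∉ S → ∀ s : Bool, ∃ x ∈ E s, x ≠ 0 ∧
      (∀ v : P, v ≠ pl ℓ → (∀ ℓ' ∈ S, pl ℓ' ≠ v) → loc v x ∈ L n v) ∧ ∀ ℓ' ∈ S, loc (pl ℓ') x ∈ Tv ℓ')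
    -- the engine's other inputs, verbatim from `ZhangInductionOnPos`
    (hA1 : ∀ (n : Finset Q) (μ : Bool) (c : H), Good n → c ∈ Sel n μ → c ≠ 0 →
      ∃ q, q ∉ n ∧ Good (insert q n) ∧ c ∉ Sel (insert q n) μ ∧ Sel (insert q n) μ ≤ Sel n μ ∧
        finrank F (Sel (insert q n) μ) + 1 = finrank F (Sel n μ) ∧ Sel (insert q n) (!μ) = Sel n (!μ))
    (hA2 : ∀ (n : Finset Q) (q₁ q₂ : Q), Good n → Good (insert q₁ n) → Good (insert q₂ (insert q₁ n)) →
      q₁ ∉ n → q₂ ∉ insert q₁ n → q₂ ∉ B (insert q₂ (insert q₁ n)) → ∃ m, κ m n ≠ 0)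
    (hA4 : ∀ (n : Finset Q) (q : Q) (S : Set Q) (s : Bool), Good n → Good (insert q n) → q ∉ n → q ∈ S →
      Sel n s ≤ SelRel (insert q n) S s)
    (hA5 : ∀ (n : Finset Q), Good n → Even n.card →
      finrank F (Sel n true) + finrank F (Sel n false) = 1 → κ m₁ n ≠ 0)
    (hA6 : ∀ (n : Finset Q), Good n → Even n.card → Odd (finrank F (Sel n true) + finrank F (Sel n false))) :
    ∀ (n : Finset Q), Good n → Even n.card → ∃ m, κ m n ≠ 0 := by
  refine ZhangInductionOnPos.exists_ne_zero_of_zhangInduction_on_pos Good Sel SelRel B κ m₁ hA1 hA2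
    (fun n hg _ _ hne ↦ ?_) hA4 hA5 hA6
  -- (A3) at the good level n: Lemma 8.4 (1)+(3) for the system κ(·, n), base set plQ '' B n
  have hB' : ∀ v ∈ plQ '' B n, ∀ m : Finset ι, loc v (κ m n) = 0 := by
    rintro v ⟨q, hq, rfl⟩ m
    exact hB n q hq m
  obtain ⟨s, d, h1, h2, h3⟩ := triangulation E loc b (L n) pl Fv Tv (fun m ↦ κ m n) (ε₀ n) (plQ '' B n)
    (Sel n) (SelRel n (B n)) (hSel n hg) (hSelRel n hg) (fun s ↦ hfin n (B n) s) hB' hpl (hLF n) (hisoL n)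
    hisoT hperf hline hrec (hcE n hg) (hcL n hg) (hcT n hg) (hfs n hg) hCheb1 hCheb2 (hSupply n hg) hne
  exact ⟨s, d, h1, h2, hfin n (B n) (!s), h3⟩

/-- **At the bottom level** (the form one starts with, `n = ∅`, assumed good): under (A1), (A2), (A4), (A5), (A6)
on good levels and the Kolyvagin-system axioms + (REC) ∕ (Cheb) ∕ (Supply) ∕ local picture at every good level,
some class `κ m ∅` is non-zero — Zhang's Thm. 9.1 `κ ≠ 0` with Lemma 8.4 no longer an input.
[cite: WZhang2014, Thm. 9.1 and Lemma 8.4] -/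
theorem exists_ne_zero_at_bottom_of_zhangInduction_on_of_kolyvaginSystem [DecidableEq ι] [DecidableEq P]
    [DecidableEq Q] (Good : Finset Q → Prop) (hgood : Good ∅)
    (Sel : Finset Q → Bool → Submodule F H) (SelRel : Finset Q → Set Q → Bool → Submodule F H)
    (B : Finset Q → Set Q) (κ : Finset ι → Finset Q → H) (m₁ : Finset ι)
    (E : Bool → Submodule F H) (loc : (v : P) → H →ₗ[F] Hv v) (b : (v : P) → Hv v →ₗ[F] Hv v →ₗ[F] F)
    (L : Finset Q → (v : P) → Submodule F (Hv v)) (pl : ι → P) (plQ : Q → P)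
    (Fv Tv : (ℓ : ι) → Submodule F (Hv (pl ℓ))) (ε₀ : Finset Q → Bool)
    (hSel : ∀ n, Good n → ∀ (s : Bool) (x : H), x ∈ Sel n s ↔ x ∈ E s ∧ ∀ v, loc v x ∈ L n v)
    (hSelRel : ∀ n, Good n → ∀ (s : Bool) (x : H),
      x ∈ SelRel n (B n) s ↔ x ∈ E s ∧ ∀ v, v ∉ plQ '' B n → loc v x ∈ L n v)
    (hfin : ∀ (n : Finset Q) (S : Set Q) (s : Bool), FiniteDimensional F (SelRel n S s))
    (hB : ∀ n, ∀ q ∈ B n, ∀ m, loc (plQ q) (κ m n) = 0)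
    (hpl : Function.Injective pl)
    (hLF : ∀ n ℓ, L n (pl ℓ) = Fv ℓ)
    (hisoL : ∀ n (v : P), ∀ x ∈ L n v, ∀ y ∈ L n v, b v x y = 0)
    (hisoT : ∀ (ℓ : ι), ∀ x ∈ Tv ℓ, ∀ y ∈ Tv ℓ, b (pl ℓ) x y = 0)
    (hperf : ∀ (ℓ : ι) (s : Bool), ∀ x ∈ E s, ∀ y ∈ E s, loc (pl ℓ) x ∈ Fv ℓ → loc (pl ℓ) x ≠ 0 →
      loc (pl ℓ) y ∈ Tv ℓ → loc (pl ℓ) y ≠ 0 → b (pl ℓ) (loc (pl ℓ) x) (loc (pl ℓ) y) ≠ 0)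
    (hline : ∀ (ℓ : ι) (s : Bool), ∃ e : Hv (pl ℓ), ∀ x ∈ E s, loc (pl ℓ) x ∈ Fv ℓ →
      ∃ a : F, loc (pl ℓ) x = a • e)
    (hrec : ∀ (x y : H) (T : Finset P), (∀ v, v ∉ T → b v (loc v x) (loc v y) = 0) →
      ∑ v ∈ T, b v (loc v x) (loc v y) = 0)
    (hcE : ∀ n, Good n → ∀ m : Finset ι, κ m n ∈ E (ε₀ n ^^ Nat.bodd m.card))
    (hcL : ∀ n, Good n → ∀ (m : Finset ι) (v : P), (∀ ℓ ∈ m, pl ℓ ≠ v) → loc v (κ m n) ∈ L n v)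
    (hcT : ∀ n, Good n → ∀ (m : Finset ι), ∀ ℓ ∈ m, loc (pl ℓ) (κ m n) ∈ Tv ℓ)
    (hfs : ∀ n, Good n → ∀ (m : Finset ι) (ℓ : ι), ℓ ∉ m →
      (loc (pl ℓ) (κ (insert ℓ m) n) = 0 ↔ loc (pl ℓ) (κ m n) = 0))
    (hCheb1 : ∀ x : H, x ≠ 0 → ∀ S : Finset ι, ∃ ℓ, ℓ ∉ S ∧ loc (pl ℓ) x ≠ 0)
    (hCheb2 : ∀ (s : Bool), ∀ x ∈ E s, ∀ y ∈ E (!s), x ≠ 0 → y ≠ 0 → ∀ S : Finset ι,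
      ∃ ℓ, ℓ ∉ S ∧ loc (pl ℓ) x ≠ 0 ∧ loc (pl ℓ) y ≠ 0)
    (hSupply : ∀ n, Good n → ∀ (ℓ : ι) (S : Finset ι), ℓ ∉ S → ∀ s : Bool, ∃ x ∈ E s, x ≠ 0 ∧
      (∀ v : P, v ≠ pl ℓ → (∀ ℓ' ∈ S, pl ℓ' ≠ v) → loc v x ∈ L n v) ∧ ∀ ℓ' ∈ S, loc (pl ℓ') x ∈ Tv ℓ')
    (hA1 : ∀ (n : Finset Q) (μ : Bool) (c : H), Good n → c ∈ Sel n μ → c ≠ 0 →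
      ∃ q, q ∉ n ∧ Good (insert q n) ∧ c ∉ Sel (insert q n) μ ∧ Sel (insert q n) μ ≤ Sel n μ ∧
        finrank F (Sel (insert q n) μ) + 1 = finrank F (Sel n μ) ∧ Sel (insert q n) (!μ) = Sel n (!μ))
    (hA2 : ∀ (n : Finset Q) (q₁ q₂ : Q), Good n → Good (insert q₁ n) → Good (insert q₂ (insert q₁ n)) →
      q₁ ∉ n → q₂ ∉ insert q₁ n → q₂ ∉ B (insert q₂ (insert q₁ n)) → ∃ m, κ m n ≠ 0)
    (hA4 : ∀ (n : Finset Q) (q : Q) (S : Set Q) (s : Bool), Good n → Good (insert q n) → q ∉ n → q ∈ S →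
      Sel n s ≤ SelRel (insert q n) S s)
    (hA5 : ∀ (n : Finset Q), Good n → Even n.card →
      finrank F (Sel n true) + finrank F (Sel n false) = 1 → κ m₁ n ≠ 0)
    (hA6 : ∀ (n : Finset Q), Good n → Even n.card → Odd (finrank F (Sel n true) + finrank F (Sel n false))) :
    ∃ m, κ m ∅ ≠ 0 :=
  exists_ne_zero_of_zhangInduction_on_of_kolyvaginSystem Good Sel SelRel B κ m₁ E loc b L pl plQ Fv Tv ε₀ hSel
    hSelRel hfin hB hpl hLF hisoL hisoT hperf hline hrec hcE hcL hcT hfs hCheb1 hCheb2 hSupply hA1 hA2 hA4 hA5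
    hA6 ∅ hgood (by simp)

end Summit.BirchSwinnertonDyer.Rank1Residual.X11b.Three.Koly.ZhangTriangulation
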